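import Summits.SmoothPoincare4.SmoothPoincare4.Theses.NoOneHandles
import Summits.SmoothPoincare4.SmoothPoincare4.Theorems.ConvexBisectionAcyclicBisectionRigiditySeamGluingCrux
import Summits.SmoothPoincare4.SmoothPoincare4.Theorems.ConvexBisectionAcyclicBisectionRigidityStubPropertyRRecognition
import Literature.Geometry.Symplectic.SteinHandlebodies
import Literature.Topology.FourManifolds.HomotopyS4CompactProofs
import Literature.Topology.FourManifolds.HomotopyS4OrientableProofs
import HarnessLib

/-!
# The disc sub-sector of the GSC lever is a theorem (line `seam-duality-cancellation`, crux
# `ConvexBisection.AcyclicBisectionRigidity`, item stmt-SmoothPoincare4-10507; lead c3, reshape s7)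

Helper file (`--supports stmt-SmoothPoincare4-10507`).  The carrier skeleton of the crux
(`Cruxes/AcyclicBisectionRigidity/Lines/seam_duality_cancellation.lean`) routes every non-double
acyclic common-contact Stein bisection of a homotopy 4-sphere `M = e₁(W₁) ∪ e₂(W₂)` through the GSC
LEVER `stub_gscOfNonDouble` ("`M` carries a Morse function without critical points of index `1`").
On the sub-sector where one half is DISC-TYPE (it admits an adapted Morse function with a single
critical point, of index `0`: `HasHandleDecomposition 3 Wᵢ (1, 0, 0, …)`) that conclusion is a
THEOREM, proved here, which is why reshape s7 scopes the registered lever by the hypothesis that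
neither half is disc-type:

* `helper_gscOfDiscTypeHalf` — disc-type FIRST half ⇒ a Morse function on `M` with no index-1
  critical point.  The other half is a compact Stein domain, hence a 2-handlebody (Gompf 1998,
  Thm. 1.3 (a): the tree's DISCHARGED `Gompf1998_thm13_indexLE_two_holds`) — an adapted Morse
  function `f₂` with all indices `≤ 2`, i.e. a handle decomposition with counts `c₂ k = #Crit_k(f₂)`,
  `c₂ 3 = 0`; gluing the one-critical-point function of `W₁` to the turned-about `f₂` across the seam
  (`SeamGluing.exists_isMorse_of_steinBisection_of_hasHandleDecomposition`, lead c1, landed) gives a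
  Morse function on `M` with `#Crit_1 = c₁ 1 + c₂ 3 = 0`.  The acyclicity conjunct of the crux is not used.
* `helper_gscOfDiscTypeHalf'` — the same for a disc-type SECOND half (the crux data is symmetric).
* `helper_discSector_of_nooh` — the disc sector WITHOUT Eliashberg: modulo Cerf (C), the Property-R
  gluing facts (R, L, T) and item stmt-SmoothPoincare4-0377 (`NoOneHandles.NoohGscStandard`), a
  disc-type half forces `M ≅ S⁴` (three-way split on the number of index-2 points of the glued
  function: `0` ⇒ twisted sphere + Cerf, `1` ⇒ Property R, `≥ 2` ⇒ item 0377).  The landed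
  `stub_residualBall` proves the same sector modulo E (Eliashberg 1990 Thm. 5.1) and C; so for the
  planner's census the Eliashberg debt is what spares the disc sector the open item 0377, nothing else.

Everything is proved; no definitions.

## References

* R. Gompf, *Handlebody construction of Stein surfaces*, Ann. of Math. 148 (1998), Thm. 1.3 (a). [Gompf1998]
* J. Milnor, *Lectures on the h-cobordism theorem* (1965), §1 and proof of Thm. 3.4. [MilnorHCobordism1965]
* R. Gompf, M. Scharlemann, A. Thompson, Geom. Topol. 14 (2010), Prop. 9.2. [GompfScharlemannThompson2010]
-/

noncomputable section

-- The namespace is prescribed by the crux protocol (`Summit.<P>.<Sub>.Theorems.<Crux>.<Line>`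
-- with `P = Sub = SmoothPoincare4`), hence the duplicated component.
set_option linter.dupNamespace false

open scoped Manifold ContDiff Topology ContinuousMap
open Set Function Literature.Topology.FourManifolds Literature.Geometry.Symplectic

namespace Summit.SmoothPoincare4.SmoothPoincare4.Theorems.AcyclicBisectionRigidity.SeamDualityCancellation

open Summit.SmoothPoincare4.SmoothPoincare4.Theses
open Summit.SmoothPoincare4.SmoothPoincare4.Theorems.AcyclicBisectionRigidity.ExchangeRecognition
  (stub_propertyRClosing_noTwoHandle)
open Summit.SmoothPoincare4.SmoothPoincare4.Theorems.AcyclicBisectionRigidity.SeamGluing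
  (exists_isMorse_of_steinBisection_of_hasHandleDecomposition)

/-- **GSC on a disc-type FIRST half.** Under the crux data WITHOUT the acyclicity conjunct — `M ≃ₕ S⁴`
bisected along a common contact seam by compact Stein domains `(W₁, J₁)`, `(W₂, J₂)` — if `W₁` admits a
handle decomposition with a single handle, of index `0`, then `M` carries a Morse function without critical
points of index `1`: the Stein half `W₂` is a 2-handlebody (Gompf 1998 Thm. 1.3 (a),
`Gompf1998_thm13_indexLE_two_holds`), and the glued function of
`SeamGluing.exists_isMorse_of_steinBisection_of_hasHandleDecomposition` has `#Crit_1 = c₁ 1 + c₂ 3 = 0 + 0`.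
[cite: Gompf1998, Thm. 1.3 (a)] [cite: MilnorHCobordism1965, §1 and proof of Thm. 3.4] -/
theorem helper_gscOfDiscTypeHalf
    (M : Type) [TopologicalSpace M] [T2Space M] [SecondCountableTopology M] [ChartedSpace (EuclideanSpace ℝ (Fin 4)) M]
    [IsManifold (𝓡 4) ∞ M] (hM : M ≃ₕ Metric.sphere (0 : EuclideanSpace ℝ (Fin 5)) 1)
    (W₁ : Type) [TopologicalSpace W₁] [ChartedSpace (EuclideanHalfSpace 4) W₁] [IsManifold (𝓡∂ 4) ∞ W₁]
    [CompactSpace W₁] (W₂ : Type) [TopologicalSpace W₂] [ChartedSpace (EuclideanHalfSpace 4) W₂]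
    [IsManifold (𝓡∂ 4) ∞ W₂] [CompactSpace W₂] (J₁ : SteinStructure W₁) (J₂ : SteinStructure W₂)
    (e₁ : W₁ → M) (e₂ : W₂ → M)
    (he₁ : Manifold.IsSmoothEmbedding (𝓡∂ 4) (𝓡 4) ∞ e₁)
    (he₂ : Manifold.IsSmoothEmbedding (𝓡∂ 4) (𝓡 4) ∞ e₂)
    (hcover : range e₁ ∪ range e₂ = univ)
    (hseam₁ : range e₁ ∩ range e₂ = e₁ '' (𝓡∂ 4).boundary W₁)
    (hseam₂ : range e₁ ∩ range e₂ = e₂ '' (𝓡∂ 4).boundary W₂)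
    (hξ : ∀ w₁ w₂, e₁ w₁ = e₂ w₂ →
      Submodule.map (mfderiv (𝓡∂ 4) (𝓡 4) e₁ w₁).toLinearMap (contactPlane J₁.J w₁) =
      Submodule.map (mfderiv (𝓡∂ 4) (𝓡 4) e₂ w₂).toLinearMap (contactPlane J₂.J w₂))
    (h₁ : HasHandleDecomposition 3 W₁ (fun k => if k = 0 then 1 else 0)) :
    ∃ F : M → ℝ, IsMorse (𝓡 4) F ∧ criticalSetOfIndex (𝓡 4) F 1 = ∅ := by
  haveI : CompactSpace M := compactSpace_of_homotopyEquiv_sphere_four_holds M hM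
  haveI : T2Space W₂ := he₂.isEmbedding.t2Space
  haveI : SecondCountableTopology W₂ := he₂.isEmbedding.secondCountableTopology
  -- the Stein half `W₂` is a 2-handlebody: an adapted Morse function with indices `≤ 2`
  obtain ⟨f₂, hf₂, hf₂i⟩ := Gompf1998_thm13_indexLE_two_holds.of_steinStructure W₂ J₂
  have hf₂' : IsMorseAdapted (𝓡∂ 4) f₂ := hf₂
  have h₂ : HasHandleDecomposition 3 W₂ (fun k => (criticalSetOfIndex (𝓡∂ 4) f₂ k).ncard) :=
    ⟨f₂, hf₂', fun _ => rfl⟩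
  have h₂3 : (criticalSetOfIndex (𝓡∂ 4) f₂ 3).ncard = 0 := by
    have hfin : (criticalSetOfIndex (𝓡∂ 4) f₂ 3).Finite :=
      (IsMorse.finite_criticalSet_holds hf₂'.isMorse).subset (criticalSetOfIndex_subset _ f₂ 3)
    rw [Set.ncard_eq_zero hfin]
    refine Set.eq_empty_of_forall_notMem fun x hx => ?_
    have hle : morseIndex (𝓡∂ 4) f₂ x ≤ 2 := hf₂i x hx.1
    rw [hx.2] at hle
    omega
  -- glue across the seam: `#Crit_1 = c₁ 1 + c₂ 3 = 0`
  obtain ⟨F, hF, hcount⟩ := exists_isMorse_of_steinBisection_of_hasHandleDecomposition M hM W₁ W₂ J₁ J₂ e₁ e₂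
    he₁ he₂ hcover hseam₁ hseam₂ hξ h₁ h₂
  have h1 : (criticalSetOfIndex (𝓡 4) F 1).ncard = 0 := by
    rw [hcount 1 3 rfl, h₂3]
    simp
  have hfin1 : (criticalSetOfIndex (𝓡 4) F 1).Finite :=
    (IsMorse.finite_criticalSet_holds hF).subset (criticalSetOfIndex_subset _ F 1)
  exact ⟨F, hF, (Set.ncard_eq_zero hfin1).1 h1⟩

/-- **GSC on a disc-type SECOND half**: the crux data is symmetric in the two halves, so
`helper_gscOfDiscTypeHalf` applies with the roles of `W₁`, `W₂` exchanged. [folklore] -/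
theorem helper_gscOfDiscTypeHalf'
    (M : Type) [TopologicalSpace M] [T2Space M] [SecondCountableTopology M] [ChartedSpace (EuclideanSpace ℝ (Fin 4)) M]
    [IsManifold (𝓡 4) ∞ M] (hM : M ≃ₕ Metric.sphere (0 : EuclideanSpace ℝ (Fin 5)) 1)
    (W₁ : Type) [TopologicalSpace W₁] [ChartedSpace (EuclideanHalfSpace 4) W₁] [IsManifold (𝓡∂ 4) ∞ W₁]
    [CompactSpace W₁] (W₂ : Type) [TopologicalSpace W₂] [ChartedSpace (EuclideanHalfSpace 4) W₂]
    [IsManifold (𝓡∂ 4) ∞ W₂] [CompactSpace W₂] (J₁ : SteinStructure W₁) (J₂ : SteinStructure W₂)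
    (e₁ : W₁ → M) (e₂ : W₂ → M)
    (he₁ : Manifold.IsSmoothEmbedding (𝓡∂ 4) (𝓡 4) ∞ e₁)
    (he₂ : Manifold.IsSmoothEmbedding (𝓡∂ 4) (𝓡 4) ∞ e₂)
    (hcover : range e₁ ∪ range e₂ = univ)
    (hseam₁ : range e₁ ∩ range e₂ = e₁ '' (𝓡∂ 4).boundary W₁)
    (hseam₂ : range e₁ ∩ range e₂ = e₂ '' (𝓡∂ 4).boundary W₂)
    (hξ : ∀ w₁ w₂, e₁ w₁ = e₂ w₂ →
      Submodule.map (mfderiv (𝓡∂ 4) (𝓡 4) e₁ w₁).toLinearMap (contactPlane J₁.J w₁) =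
      Submodule.map (mfderiv (𝓡∂ 4) (𝓡 4) e₂ w₂).toLinearMap (contactPlane J₂.J w₂))
    (h₂ : HasHandleDecomposition 3 W₂ (fun k => if k = 0 then 1 else 0)) :
    ∃ F : M → ℝ, IsMorse (𝓡 4) F ∧ criticalSetOfIndex (𝓡 4) F 1 = ∅ := by
  have hcover' : range e₂ ∪ range e₁ = univ := by rw [union_comm]; exact hcover
  have hseam₁' : range e₂ ∩ range e₁ = e₂ '' (𝓡∂ 4).boundary W₂ := by rw [inter_comm]; exact hseam₂
  have hseam₂' : range e₂ ∩ range e₁ = e₁ '' (𝓡∂ 4).boundary W₁ := by rw [inter_comm]; exact hseam₁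
  have hξ' : ∀ w₂ w₁, e₂ w₂ = e₁ w₁ →
      Submodule.map (mfderiv (𝓡∂ 4) (𝓡 4) e₂ w₂).toLinearMap (contactPlane J₂.J w₂) =
      Submodule.map (mfderiv (𝓡∂ 4) (𝓡 4) e₁ w₁).toLinearMap (contactPlane J₁.J w₁) :=
    fun w₂ w₁ h => (hξ w₁ w₂ h.symm).symm
  exact helper_gscOfDiscTypeHalf M hM W₂ W₁ J₂ J₁ e₂ e₁ he₂ he₁ hcover' hseam₁' hseam₂' hξ' h₂

/-- **The disc sector WITHOUT Eliashberg.** A disc-type half makes `M` geometrically simply connected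
(`helper_gscOfDiscTypeHalf`), so the disc sector of the crux closes modulo Cerf's `Γ₄ = 0` (`hC`), Gabai's
Property R (`hPR`), Laudenbach–Poénaru (`hLP`), the trace bridge (`hT`) and item stmt-SmoothPoincare4-0377
(`NoOneHandles.NoohGscStandard`, the hypothesis `h0377`): split on the number `c₂` of index-2 critical points
of the glued function — `0` ⇒ twisted sphere, Cerf (`ExchangeRecognition.stub_propertyRClosing_noTwoHandle`);
`1` ⇒ Property R (`stub_propertyR_recognition`); `≥ 2` ⇒ item 0377, with `M` packaged as a `HomotopySphere 4`
(compact and orientable by the PROVED `compactSpace_of_homotopyEquiv_sphere_four_holds`,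
`isOrientable_of_homotopyEquiv_sphere_four_holds`). [cite: GompfScharlemannThompson2010, Prop. 9.2]
[cite: CerfDiffeoSphere1968, Γ₄ = 0] -/
theorem helper_discSector_of_nooh (h0377 : NoOneHandles.NoohGscStandard)
    (hC : cerf_twistedSphere_four) (hPR : isUnknot_of_isIntegralSurgery_zero)
    (hLP : exists_diffeomorph_comp_incl_eq.{0}) (hT : exists_framedKnot_of_hasHandleDecomposition_oneZeroOne)
    (M : Type) [TopologicalSpace M] [T2Space M] [SecondCountableTopology M] [ChartedSpace (EuclideanSpace ℝ (Fin 4)) M]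
    [IsManifold (𝓡 4) ∞ M] (hM : M ≃ₕ Metric.sphere (0 : EuclideanSpace ℝ (Fin 5)) 1)
    (W₁ : Type) [TopologicalSpace W₁] [ChartedSpace (EuclideanHalfSpace 4) W₁] [IsManifold (𝓡∂ 4) ∞ W₁]
    [CompactSpace W₁] (W₂ : Type) [TopologicalSpace W₂] [ChartedSpace (EuclideanHalfSpace 4) W₂]
    [IsManifold (𝓡∂ 4) ∞ W₂] [CompactSpace W₂] (J₁ : SteinStructure W₁) (J₂ : SteinStructure W₂)
    (e₁ : W₁ → M) (e₂ : W₂ → M)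
    (he₁ : Manifold.IsSmoothEmbedding (𝓡∂ 4) (𝓡 4) ∞ e₁)
    (he₂ : Manifold.IsSmoothEmbedding (𝓡∂ 4) (𝓡 4) ∞ e₂)
    (hcover : range e₁ ∪ range e₂ = univ)
    (hseam₁ : range e₁ ∩ range e₂ = e₁ '' (𝓡∂ 4).boundary W₁)
    (hseam₂ : range e₁ ∩ range e₂ = e₂ '' (𝓡∂ 4).boundary W₂)
    (hξ : ∀ w₁ w₂, e₁ w₁ = e₂ w₂ →
      Submodule.map (mfderiv (𝓡∂ 4) (𝓡 4) e₁ w₁).toLinearMap (contactPlane J₁.J w₁) =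
      Submodule.map (mfderiv (𝓡∂ 4) (𝓡 4) e₂ w₂).toLinearMap (contactPlane J₂.J w₂))
    (h₁ : HasHandleDecomposition 3 W₁ (fun k => if k = 0 then 1 else 0)) :
    Nonempty (M ≃ₘ⟮𝓡 4, 𝓡 4⟯ Metric.sphere (0 : EuclideanSpace ℝ (Fin 5)) 1) := by
  haveI : CompactSpace M := compactSpace_of_homotopyEquiv_sphere_four_holds M hM
  obtain ⟨F, hF, h1⟩ := helper_gscOfDiscTypeHalf M hM W₁ W₂ J₁ J₂ e₁ e₂ he₁ he₂ hcover hseam₁ hseam₂ hξ h₁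
  by_cases h2 : (criticalSetOfIndex (𝓡 4) F 2).ncard ≤ 1
  · rcases Nat.le_one_iff_eq_zero_or_eq_one.1 h2 with h20 | h21
    · -- `c₂ = 0`: twisted sphere, Cerf
      have hfin2 : (criticalSetOfIndex (𝓡 4) F 2).Finite :=
        (IsMorse.finite_criticalSet_holds hF).subset (criticalSetOfIndex_subset _ F 2)
      exact stub_propertyRClosing_noTwoHandle hC M hM F hF h1 ((Set.ncard_eq_zero hfin2).1 h20)
    · -- `c₂ = 1`: Property R
      exact stub_propertyR_recognition hC hPR hLP hT M hM F hF h1 h21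
  · -- `c₂ ≥ 2`: item 0377 (`M` packaged as a `HomotopySphere 4`)
    obtain ⟨o⟩ := isOrientable_of_homotopyEquiv_sphere_four_holds M hM
    exact h0377 ⟨M, o, ⟨hM⟩⟩ F hF h1

end Summit.SmoothPoincare4.SmoothPoincare4.Theorems.AcyclicBisectionRigidity.SeamDualityCancellation

end
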